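import Summits.Ventures.PackingBounds.ThreePointCert.K5d14Agg1
import Summits.Ventures.PackingBounds.ThreePointCert.K5d14Agg2
import Summits.Ventures.PackingBounds.ThreePointCert.K5d14Agg3

/-!
# κ(5) ≤ 44: kernel check of constraint (i') (trie residual `checkI3`)

Framing: lottery ticket; floor = certified bounds/negative ranges. Venture `PackingBounds` (cell
`pub-packcert`), three-point SDP family. Kernel check of one polynomial identity of the Bachoc–Vallentin
certificate (n = 5, s = 1/2, degree d = 14, multiplier set = cell mode sym2) whose integer data are the
`K5d14Leaf*`/`K5d14Agg1` files (emitter `emitleanS2.py`; split out of the Proof file by lp gen 8 so that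
each file stays within the farm's elaboration budget).
-/

namespace Summit.Ventures.PackingBounds.ThreePointCert.K5d14

open Literature.Geometry.DiscreteGeometry Literature.Geometry.DiscreteGeometry.PolyCert PolyCert.SPoly

set_option maxRecDepth 100000 in
set_option maxHeartbeats 0 in
/-- The certificate passes the check of constraint `(i')`. -/
theorem cert_I : checkI3 K5d14.cert K5d14.polys = true := by decide +kernel

end Summit.Ventures.PackingBounds.ThreePointCert.K5d14
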